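import Literature.LinearAlgebra.RootSystem.AffineWeylGroupOmegaSpecialNodes
import Literature.LinearAlgebra.RootSystem.AffineWeylGroupOmegaLinearPart
import Literature.LinearAlgebra.RootSystem.AffineWeylGroupOmegaLongestElements
import HarnessLib

/-!
# The orders of the elements of `Ω`: `ord(ρ) = ord(w_{Π(i)} w_Π)`, and `ρ² = 1` when `-1 ∈ W` (Iwahori–Matsumoto 1965 §1.8)

N. Iwahori, H. Matsumoto, *On some Bruhat decomposition and the structure of the Hecke rings of p-adic Chevalley groups*, Publ. Math. IHÉS
25 (1965) 5–48 [IwahoriMatsumoto1965] (held `paper:doi-10-1007-bf02684396`, PDF p. 15 = journal p. 253), §1.8, after Corollary 1.22: «We note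
here that the order of `ρ = T(ε_i) w_{Π(i)} w_Π ∈ Ω` is equal to the order of `w_{Π(i)} w_Π` since the homomorphism `φ : DW → W` is injective
on `Ω`. Thus, if the Weyl group `W` has a non-trivial center, then `w_Π = -1` and the order of `ρ` is equal to `2`. Hence for types `B_l`, `C_l`,
`D_l` (`l` = even), `G_2`, `F_4`, `E_7`, `E_8`, every element `ρ` of `Ω` (`ρ ≠ 1`) is of order `2`.» (`w_Π` is the longest element of `W`, `w_{Π(i)}`
that of the parabolic subgroup on `Π ∖ {α_i}`; Proposition 1.18: `Ω ∖ {1} = {T(ε_i) w_{Π(i)} w_Π : (α₀, ε_i) = 1}`, tree row g47-#5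
`eq_longest_mul_longest`; Proposition 1.21 (ii): `φ` is injective on `Ω`, tree `eq_of_linear_eq`.)

THIS FILE (lane `lit-hodgefound`, prover seat p40, generation 48, row g48-#6; THEOREMS ONLY — no definition, instance, notation or named fact; net
debt 0), CONVENTIONS of the `AffineWeylGroup*` files (`Ŵ_a = DW` acts on the weight space `M`; `Ω = {o ∈ Ŵ_a | oA∘ = A∘}`, `A∘ = {0 < ⟨x, α^∨⟩
< 1 ∀ α ≻ 0}`; the «image in `W`» of `o` is its linear part `o.linear`, and for `o = t(v)·g` it is the weight action of `g ∈ Aut P`).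

* §1 ★ `pow_mem_stabilizer` (`Ω` is closed under powers), ★★ `pow_eq_one_iff_linear_pow_eq_one` (for `o ∈ Ω`: `oⁿ = 1 ⟺ φ(o)ⁿ = 1`), ★★★
  `orderOf_eq_orderOf_linear` («THE ORDER OF `ρ ∈ Ω` IS EQUAL TO THE ORDER OF [ITS IMAGE IN `W`] SINCE `φ` IS INJECTIVE ON `Ω`»), ★★
  `orderOf_eq_orderOf_aut` (for `o = t(v)·g ∈ Ω`: `ord(o) = ord(g)`).
* §2 ★ `forall_not_isPos_smul_of_smul_eq_neg` (an element of `Aut P` acting as `-1` on `M` sends `Φ⁺` to `Φ⁻`, so it is `w_Π` when it lies in `W`),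
  ★ `commute_of_smul_eq_neg` (it is central in `Aut P`), ★★★ `mul_self_eq_one_of_smul_eq_neg` («IF … `w_Π = -1` … THE ORDER OF `ρ` IS EQUAL TO `2`»:
  if some `w ∈ W` acts as `-1` on `M`, every `o ∈ Ω` satisfies `o² = 1` — through Proposition 1.18, `g = w_{Π(i)} w_Π` with both factors involutions
  and `w_Π = -1` central), ★★ `orderOf_eq_two_of_smul_eq_neg` («every element `ρ` of `Ω` (`ρ ≠ 1`) is of order `2`»).

BY NAME, nothing restated: rows g44-#11 (`mul_mem_stabilizer`), g45 (`eq_of_linear_eq` — `φ` injective on `Ω`; `exists_perm_conj_wallReflection_eq`,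
`eq_one_of_perm_none`, `coroot'_apply_zero_of_perm_none_eq_some` — the special node of `o`), g47-#5 (`eq_longest_mul_longest`), `ParabolicLongestElement`
(`exists_longest_mem_closure_image`, `longest_mul_self`), `WeylGroupFundamentalDomain` (`mul_self_eq_one_of_forall_not_isPos_smul`), g44-#1
(`exists_of_mem_extendedAffineWeylGroup`, `linear_affineHom`, `constVAdd_mul_affineHom_apply_zero`); Mathlib `orderOf_eq_orderOf_iff`, `orderOf_injective`,
`RootPairing.Equiv.weightHom_injective`.

## Scope caveats

The hypothesis of §2 is «`-1 ∈ W`» (some `w ∈ W` acts as `x ↦ -x` on `M`), the operative condition; the printed «if the Weyl group `W` has a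
non-trivial center, then `w_Π = -1`» (the centre of an irreducible `W` is `{1}` or `{±1}`) and the list of types are NOT formalised here. Finite reduced
crystallographic root SYSTEMS over an ordered field of characteristic zero (`[P.IsRootSystem]`, for `φ` injective on `Ω`), `η` with `hη` (highest
coroot, so that `A∘` is an alcove).

## References

* [IwahoriMatsumoto1965] N. Iwahori, H. Matsumoto, Publ. Math. IHÉS 25 (1965) 5–48, §1.8, remark after Corollary 1.22 (p. 253); §1.7 Proposition 1.18;
  Proposition 1.21 (ii).
* [Bourbaki2002LieGroups46] N. Bourbaki, *Lie Groups and Lie Algebras, Chapters 4–6*, Springer (2002), Ch. VI §2 no. 3 Prop. 6 (cite-only).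
-/

noncomputable section

open Module Set Function Submodule

namespace Literature.LinearAlgebra.RootSystem

namespace Base

variable {ι K M N : Type*} [Field K] [LinearOrder K] [IsStrictOrderedRing K] [AddCommGroup M] [Module K M]
  [AddCommGroup N] [Module K N] [Fintype ι] [DecidableEq ι]
  {P : RootPairing ι K M N} [CharZero K] [P.IsCrystallographic] [P.IsReduced] (b : P.Base)
  [Nonempty ι] {η : ι} (hη : ∀ k, P.coroot η - P.coroot k ∈ AddSubmonoid.closure (P.coroot '' (b.support : Set ι)))

/-! ## §1 `ord(ρ) = ord(φ(ρ))` -/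

section Order

include hη

omit hη [IsStrictOrderedRing K] [Fintype ι] [DecidableEq ι] [P.IsCrystallographic] [P.IsReduced] [Nonempty ι] in
/-- ★ **`Ω` IS CLOSED UNDER POWERS**: `oⁿ ∈ Ŵ_a` and `oⁿA∘ = A∘` for `o ∈ Ω`. [cite: IwahoriMatsumoto1965, §1.7 ("a subgroup Ω of DW")] -/
theorem pow_mem_stabilizer {o : M ≃ᵃ[K] M} (ho : o ∈ extendedAffineWeylGroup P)
    (hoA : o '' {x : M | ∀ i, b.IsPos i → 0 < P.coroot' i x ∧ P.coroot' i x < 1} =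
      {x : M | ∀ i, b.IsPos i → 0 < P.coroot' i x ∧ P.coroot' i x < 1}) (n : ℕ) :
    o ^ n ∈ extendedAffineWeylGroup P ∧ ⇑(o ^ n) '' {x : M | ∀ i, b.IsPos i → 0 < P.coroot' i x ∧ P.coroot' i x < 1} =
      {x : M | ∀ i, b.IsPos i → 0 < P.coroot' i x ∧ P.coroot' i x < 1} := by
  induction n with
  | zero =>
    rw [pow_zero]
    exact ⟨one_mem _, by rw [AffineEquiv.coe_one, image_id]⟩
  | succ n ih =>
    rw [pow_succ]
    exact mul_mem_stabilizer b ih.1 ho ih.2 hoA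

/-- ★★ **`oⁿ = 1 ⟺ φ(o)ⁿ = 1` FOR `o ∈ Ω`**, `φ(o) = o.linear` its image in `W` («the homomorphism `φ : DW → W` is injective on `Ω`», tree
`eq_of_linear_eq`, applied to `oⁿ ∈ Ω` and `1`). [cite: IwahoriMatsumoto1965, §1.8 remark after Cor. 1.22 and Prop. 1.21 (ii)] -/
theorem pow_eq_one_iff_linear_pow_eq_one [P.IsRootSystem] {o : M ≃ᵃ[K] M} (ho : o ∈ extendedAffineWeylGroup P)
    (hoA : o '' {x : M | ∀ i, b.IsPos i → 0 < P.coroot' i x ∧ P.coroot' i x < 1} =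
      {x : M | ∀ i, b.IsPos i → 0 < P.coroot' i x ∧ P.coroot' i x < 1}) (n : ℕ) :
    o ^ n = 1 ↔ o.linear ^ n = 1 := by
  classical
  constructor
  · intro h
    rw [← AffineEquiv.linearHom_apply, ← map_pow, h, map_one]
  · intro h
    obtain ⟨hn, hnA⟩ := pow_mem_stabilizer b ho hoA n
    refine eq_of_linear_eq b hη hn (one_mem _) hnA (by rw [AffineEquiv.coe_one, image_id]) ?_
    rw [← AffineEquiv.linearHom_apply, map_pow, AffineEquiv.linearHom_apply, h, ← AffineEquiv.linearHom_apply, map_one]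

/-- ★★★ **«THE ORDER OF `ρ ∈ Ω` IS EQUAL TO THE ORDER OF [ITS IMAGE IN `W`] SINCE THE HOMOMORPHISM `φ : DW → W` IS INJECTIVE ON `Ω`»**:
`orderOf o = orderOf o.linear` for `o ∈ Ω`. [cite: IwahoriMatsumoto1965, §1.8 remark after Corollary 1.22 ("the order of ρ = T(ε_i) w_{Π(i)} w_Π ∈ Ω is equal to the order of w_{Π(i)} w_Π since the homomorphism φ : DW → W is injective on Ω")] -/
theorem orderOf_eq_orderOf_linear [P.IsRootSystem] {o : M ≃ᵃ[K] M} (ho : o ∈ extendedAffineWeylGroup P)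
    (hoA : o '' {x : M | ∀ i, b.IsPos i → 0 < P.coroot' i x ∧ P.coroot' i x < 1} =
      {x : M | ∀ i, b.IsPos i → 0 < P.coroot' i x ∧ P.coroot' i x < 1}) :
    orderOf o = orderOf o.linear :=
  orderOf_eq_orderOf_iff.mpr fun n ↦ pow_eq_one_iff_linear_pow_eq_one b hη ho hoA n

/-- ★★ **FOR `o = t(v)·g ∈ Ω`: `ord(o) = ord(g)`** (the image of `o` in `W` is `g`, acting on `M` through the faithful weight representation, Mathlib
`RootPairing.Equiv.weightHom_injective`). [cite: IwahoriMatsumoto1965, §1.8 remark after Corollary 1.22 ("is equal to the order of w_{Π(i)} w_Π")] -/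
theorem orderOf_eq_orderOf_aut [P.IsRootSystem] {v : M} {g : P.Aut}
    (ho : AffineEquiv.constVAdd K M v * affineHom P g ∈ extendedAffineWeylGroup P)
    (hoA : (AffineEquiv.constVAdd K M v * affineHom P g) '' {x : M | ∀ i, b.IsPos i → 0 < P.coroot' i x ∧ P.coroot' i x < 1} =
      {x : M | ∀ i, b.IsPos i → 0 < P.coroot' i x ∧ P.coroot' i x < 1}) :
    orderOf (AffineEquiv.constVAdd K M v * affineHom P g) = orderOf g := by
  rw [orderOf_eq_orderOf_linear b hη ho hoA]
  have hlin : (AffineEquiv.constVAdd K M v * affineHom P g).linear = RootPairing.Equiv.weightHom P g := by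
    rw [← AffineEquiv.linearHom_apply, map_mul, AffineEquiv.linearHom_apply, AffineEquiv.linearHom_apply, AffineEquiv.linear_constVAdd,
      linear_affineHom, show (LinearEquiv.refl K M : M ≃ₗ[K] M) = 1 from rfl, one_mul]
  rw [hlin]
  exact orderOf_injective (RootPairing.Equiv.weightHom P) (RootPairing.Equiv.weightHom_injective P) g

end Order

/-! ## §2 `-1 ∈ W`: every element of `Ω` has order at most `2` -/

section MinusOne

omit [LinearOrder K] [IsStrictOrderedRing K] [Fintype ι] [DecidableEq ι] [P.IsCrystallographic] [P.IsReduced] [Nonempty ι] in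
/-- ★ **AN AUTOMORPHISM ACTING AS `-1` ON `M` SENDS EVERY ROOT TO ITS NEGATIVE**, hence `Φ⁺` into `Φ⁻` (so, if it lies in `W`, it is `w_Π`, tree
`eq_of_forall_not_isPos_smul`). [cite: IwahoriMatsumoto1965, §1.8 remark after Corollary 1.22 ("then w_Π = -1")] -/
theorem forall_not_isPos_smul_of_smul_eq_neg {w : P.Aut} (hw : ∀ x : M, w • x = -x) : ∀ i, b.IsPos i → ¬ b.IsPos (w • i) := by
  letI := P.indexNeg
  intro i hi
  have h1 : w • i = -i := by
    apply P.root.injective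
    change P.root (w • i) = P.root (P.reflectionPerm i i)
    rw [RootPairing.root_reflectionPerm, RootPairing.reflection_apply_self, smul_index_eq, RootPairing.Equiv.root_indexEquiv_eq_smul, hw]
  rw [h1, RootPairing.Base.IsPos.neg_iff_not]
  exact not_not.mpr hi

omit [LinearOrder K] [IsStrictOrderedRing K] [Fintype ι] [DecidableEq ι] [CharZero K] [P.IsCrystallographic] [P.IsReduced] [Nonempty ι] in
/-- ★ **SUCH AN AUTOMORPHISM IS CENTRAL IN `Aut P`** (an automorphism is determined by its weight action, Mathlib `weightHom_injective`, and `-1`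
commutes with every linear map). [cite: IwahoriMatsumoto1965, §1.8 remark after Corollary 1.22 ("non-trivial center … w_Π = -1")] -/
theorem commute_of_smul_eq_neg {w : P.Aut} (hw : ∀ x : M, w • x = -x) (h : P.Aut) : h * w = w * h := by
  apply RootPairing.Equiv.weightHom_injective P
  rw [map_mul, map_mul]
  refine LinearEquiv.ext fun x ↦ ?_
  change h • (w • x) = w • (h • x)
  rw [hw, hw, smul_neg]

include hη

/-- ★★★ **«IF THE WEYL GROUP `W` HAS A NON-TRIVIAL CENTER, THEN `w_Π = -1` AND THE ORDER OF `ρ` IS EQUAL TO `2`»** — stated from the operative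
hypothesis `-1 ∈ W` (some `w ∈ W` acts as `x ↦ -x`): every `o ∈ Ω` satisfies `o² = 1`. For `o ≠ 1`, `o = t(ϖ_j)·g` over its special node `j`
(rows g45), `g = w_{Δ∖{j}} w_Π` (Proposition 1.18, row g47-#5) with `w_{Δ∖{j}}² = 1`, `w_Π² = 1`, `w_Π = -1` central, so `g² = 1`, and `φ` is
injective on `Ω` (§1). [cite: IwahoriMatsumoto1965, §1.8 remark after Corollary 1.22 ("Thus, if the Weyl group W has a non-trivial center, then w_Π = −1 and the order of ρ is equal to 2")] -/
theorem mul_self_eq_one_of_smul_eq_neg [P.IsRootSystem] [DecidablePred b.IsPos] {w : P.Aut} (hwW : w ∈ P.weylGroup) (hw : ∀ x : M, w • x = -x)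
    {o : M ≃ᵃ[K] M} (ho : o ∈ extendedAffineWeylGroup P)
    (hoA : o '' {x : M | ∀ i, b.IsPos i → 0 < P.coroot' i x ∧ P.coroot' i x < 1} =
      {x : M | ∀ i, b.IsPos i → 0 < P.coroot' i x ∧ P.coroot' i x < 1}) : o * o = 1 := by
  classical
  -- the node permutation of `o`; if it fixes the new node, `o = 1`
  obtain ⟨σ, hσ⟩ := exists_perm_conj_wallReflection_eq b hη ho hoA
  rcases hnone : σ none with _ | j
  · rw [eq_one_of_perm_none b hη ho hoA hσ hnone, mul_one]
  -- otherwise `o(0) = ϖ_j` is the minuscule fundamental weight of the special node `j`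
  obtain ⟨hv, -⟩ := coroot'_apply_zero_of_perm_none_eq_some b hη ho hoA hσ hnone
  obtain ⟨v, hvP, g, hg, rfl⟩ := exists_of_mem_extendedAffineWeylGroup P ho
  rw [constVAdd_mul_affineHom_apply_zero] at hv
  -- Proposition 1.18: `g = w_{Δ∖{j}} · w_Π`, with `w_Π = w` (it sends `Φ⁺` to `Φ⁻`)
  have hJ : ((b.support : Set ι)) \ {(j : ι)} ⊆ (b.support : Set ι) := fun x hx ↦ hx.1
  obtain ⟨wJ, hwJ, hwJ'⟩ := exists_longest_mem_closure_image b hJ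
  have hw' := forall_not_isPos_smul_of_smul_eq_neg b hw
  have hgeq := eq_longest_mul_longest b hη hvP hg hoA hv hwW hw' hwJ hwJ'
  -- `g² = w_J w w_J w = w_J² w² = 1`
  have hg2 : g * g = 1 := by
    rw [hgeq, mul_assoc, ← mul_assoc w wJ w, ← commute_of_smul_eq_neg hw wJ, mul_assoc, mul_self_eq_one_of_forall_not_isPos_smul b hwW hw',
      mul_one, longest_mul_self b hJ hwJ hwJ']
  -- hence `(o²)`'s image in `W` is `1`, and `o² = 1`
  rw [← pow_two, pow_eq_one_iff_linear_pow_eq_one b hη ho hoA 2, ← AffineEquiv.linearHom_apply, map_mul, AffineEquiv.linearHom_apply,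
    AffineEquiv.linearHom_apply, AffineEquiv.linear_constVAdd, linear_affineHom, show (LinearEquiv.refl K M : M ≃ₗ[K] M) = 1 from rfl, one_mul,
    pow_two, ← map_mul, hg2, map_one]

/-- ★★ **«HENCE … EVERY ELEMENT `ρ` OF `Ω` (`ρ ≠ 1`) IS OF ORDER `2`»** when `-1 ∈ W`. [cite: IwahoriMatsumoto1965, §1.8 remark after Corollary 1.22 ("for types B_l, C_l, D_l (l even), G_2, F_4, E_7, E_8, every element ρ of Ω (ρ ≠ 1) is of order 2")] -/
theorem orderOf_eq_two_of_smul_eq_neg [P.IsRootSystem] [DecidablePred b.IsPos] {w : P.Aut} (hwW : w ∈ P.weylGroup) (hw : ∀ x : M, w • x = -x)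
    {o : M ≃ᵃ[K] M} (ho : o ∈ extendedAffineWeylGroup P)
    (hoA : o '' {x : M | ∀ i, b.IsPos i → 0 < P.coroot' i x ∧ P.coroot' i x < 1} =
      {x : M | ∀ i, b.IsPos i → 0 < P.coroot' i x ∧ P.coroot' i x < 1}) (h1 : o ≠ 1) : orderOf o = 2 :=
  orderOf_eq_prime (by rw [pow_two]; exact mul_self_eq_one_of_smul_eq_neg b hη hwW hw ho hoA) h1

end MinusOne

end Base

end Literature.LinearAlgebra.RootSystem
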